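import Summits.ResolutionOfSingularities.ResolutionOfSingularities.Theorems.RadicialJungCleanModelsCcurveAssemblyGen
import Summits.ResolutionOfSingularities.ResolutionOfSingularities.Theorems.RadicialJungCleanModelsCcurveRegFinal
import HarnessLib

/-!
# [GENERAL-FIELD VERSION (lead g7, Sketch rev 30): `Ccurve.cleanLU3Defect_of_properCoarsening (hCP)` — the COMPOSITE case of :249 for an ARBITRARY ground field of characteristic `p`, modulo F-02 only; no `PerfectField` hypothesis.]
# Route `RadicialJung`, crux `CleanModels` (stmt-15917) — (C-curve) sub-line: THE TARGET over perfect fields, modulo F-02 only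

Lead `res-B-lead-1` g7.  OURS · counted 0.  Nothing here proves resolution in characteristic `p`; resolution in char `p` is NOT proved.

`Ccurve.cleanLU3Defect_of_properCoarsening_perfect (hCP : CossartPiltant2019)`: clean local uniformization of the `K^p`-line of `g₀` at a zero-dimensional valuation
ring `O` with a 3-dimensional regular finitely generated centre, NO divisorial coarsening, and a PROPER coarsening `O₁`, over a PERFECT ground field of
characteristic `p` — the composite part («class (C-curve)») of the research residual :249‴ of line `Sketch` of stmt-15917, over perfect fields.  It is the
kernel-checked composition ✓ `cleanLU3Defect_of_properCoarsening_perfect_of` (rebased D2 ✓, lift ✓, closed-point persist by form ✓) with the geometric core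
✓ `curveRegularize` (classical, F-32-free).  The ONLY printed input is F-02 = `CossartPiltant2019` (arithmetical local uniformization in dimension three,
used once on the rebased field `k(t)` by ✓ `Ccurve.rebaseD2`).  For Sketch rev 29 the stub :249‴ is narrowed by
`¬ (PerfectField k ∧ ∃ O₁, O ≤ O₁ ∧ O₁ ≠ O ∧ O₁ ≠ ⊤)`.
-/

noncomputable section

set_option linter.dupNamespace false

open IsLocalRing Literature.AlgebraicGeometry.Resolution
open Summit.ResolutionOfSingularities.ResolutionOfSingularities.Theorems

namespace Summit.ResolutionOfSingularities.ResolutionOfSingularities.Theorems.RadicialJung.CleanModels.Ccurve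

/-- **The (C-curve) slice of :249‴ over perfect fields, modulo F-02 (`CossartPiltant2019`) only** — see the module docstring. [folklore] -/
theorem cleanLU3Defect_of_properCoarsening (hCP : CossartPiltant2019.{0}) :
    ∀ (p : ℕ), p.Prime →
    ∀ (k : Type) [Field k] [CharP k p] (K : Type) [Field K] [Algebra k K]
    (O : ValuationSubring K) (A : Subalgebra k K), A.toSubring ≤ O.toSubring → A.FG → IsFractionRing A K →
    ringKrullDim A ≤ 3 → IsRegularLocalRing (locAtCentre A.toSubring O) →
    ringKrullDim (locAtCentre A.toSubring O) = 3 →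
    (∀ (T : Subring K) (hT : T ≤ O.toSubring), A.toSubring ≤ T → (subringCentre T O hT).IsMaximal) →
    ∀ g₀ : K, (∀ c : K, c ^ p ≠ g₀) →
    ¬ (∃ (O₁ : ValuationSubring K), O ≤ O₁ ∧ O₁ ≠ ⊤ ∧ ∃ y : Fin 2 → K, (∀ i, y i ∈ O) ∧
      ∀ P : MvPolynomial (Fin 2) k, P ≠ 0 → O₁.valuation (MvPolynomial.aeval y P) = 1) →
    ∀ (O₁ : ValuationSubring K), O ≤ O₁ → O₁ ≠ O → O₁ ≠ ⊤ →
    ∃ (A' : Subalgebra k K), A'.toSubring ≤ O.toSubring ∧ A ≤ A' ∧ A'.FG ∧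
    ∃ (_ : IsRegularLocalRing ↥(locAtCentre A'.toSubring O)) (c : Fin p → K), (∃ j : Fin p, (j : ℕ) ≠ 0 ∧ c j ≠ 0) ∧
    ((∃ (d m : ℕ) (hmd : m ≤ d) (t : Fin d → ↥(locAtCentre A'.toSubring O)) (a : Fin m → ℕ) (u : ↥(locAtCentre A'.toSubring O)), IsUnit u ∧
    Ideal.span (Set.range t) = IsLocalRing.maximalIdeal ↥(locAtCentre A'.toSubring O) ∧
    ringKrullDim ↥(locAtCentre A'.toSubring O) = (d : WithBot ℕ∞) ∧ 0 < m ∧ (∀ i, ¬ p ∣ a i) ∧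
    (∑ j : Fin p, c j ^ p * g₀ ^ (j : ℕ)) = (u : K) * ∏ i : Fin m, ((t (Fin.castLE hmd i) : ↥(locAtCentre A'.toSubring O)) : K) ^ (a i)) ∨
    (∃ u : ↥(locAtCentre A'.toSubring O), IsUnit u ∧ (∑ j : Fin p, c j ^ p * g₀ ^ (j : ℕ)) = (u : K) ∧
    ∀ c' : ↥(locAtCentre A'.toSubring O), u - c' ^ p ∉ IsLocalRing.maximalIdeal ↥(locAtCentre A'.toSubring O)) ∨
    (∃ s c' : ↥(locAtCentre A'.toSubring O), (∑ j : Fin p, c j ^ p * g₀ ^ (j : ℕ)) = (s : K) ∧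
    s - c' ^ p ∈ IsLocalRing.maximalIdeal ↥(locAtCentre A'.toSubring O) ∧
    s - c' ^ p ∉ IsLocalRing.maximalIdeal ↥(locAtCentre A'.toSubring O) ^ 2)) :=
  cleanLU3Defect_of_properCoarsening_gen_of curveRegularize hCP

end Summit.ResolutionOfSingularities.ResolutionOfSingularities.Theorems.RadicialJung.CleanModels.Ccurve

end
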